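import Literature.Geometry.DiscreteGeometry.KissingRigidity
import HarnessLib

/-!
# The pairing lemma: two isosceles contact triangles of the Delaunay polyhedron on a common base
# have a base of length `≤ 2√2` (Hales 2012, proof of Theorem 2: "we cannot have
# `(r₁,s₁,t₁) = (r₂,s₂,t₂) = (2,0,1)` because a quadrilateral of side length `2` always has a
# diagonal of length at most `√8`") — proved

Topic `Literature/Geometry/DiscreteGeometry`; provefact brick for `Hales2012_contactGraphTame`,
companion of `KissingMainEstimate.lean` (the per-triangle main estimate, Theorem 2).  In the superadditivity step of
the proof of Theorem 2 Hales needs that two Delaunay triangles of type `(2,0,1)` (two contact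
edges and a long edge of length `≥ 3.0`) never share their long edge.  On the unit sphere
(`X = V/2`) and for the facets of `conv X` this is the following statement, which we PROVE in the
sharper form actually true: if the vertices `v, w` are both in contact with both endpoints of the
pair `{b, x}` (a spherical rhombus `v b w x` of side `60°`), then

* `rhombus_sum_eq_smul` (vector form, any four unit vectors of `ℝ³`): `v + w = μ (b + x)` with
  `μ (1 + ⟪b, x⟫) = 1` — the two diagonals of an equilateral spherical quadrilateral are
  perpendicular and their midpoint directions coincide (cf. `rhombus_diagonal_relation`,
  `rhombus_smul_add_eq`);
* `inner_eq_zero_of_rhombus_tight` (**same facet**): if `v, w, b, x` are vertices of one facet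
  (`⟪c, ·⟫ = 1`) then `⟪b, x⟫ = 0` (a cocircular rhombus is a square: diagonal `2√2` on
  `S²(2)`);
* `inner_pos_of_rhombus_tight` (**two facets**): if `v, b, x` are vertices of the facet of `c`
  and `⟪c, w⟫ < 1` (e.g. `w` a vertex of the other facet through the hull edge `{b, x}`) then
  `⟪b, x⟫ > 0` (diagonal `< 2√2` on `S²(2)`);

so in either case the common base is NOT "very long" (`⟪b, x⟫ ≥ 0`, length `≤ 2√2 < 3.0` on
`S²(2)`): `not_inner_neg_of_rhombus_tight`.

Everything is PROVED; no named facts.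

## References
* T. C. Hales, arXiv:1209.6043 (2012), proof of Theorem 2 (superadditivity of `d₃`, the remark
  on two regions of type `(2,0,1)`); proof of Lemma 3 ("one of its diagonals is necessarily at
  least `√8`"). [`Hales2012`]
-/

noncomputable section

namespace Literature.Geometry.DiscreteGeometry

open Real RealInnerProductSpace

section Pairing

local notation "E3" => EuclideanSpace ℝ (Fin 3)

/-- **The diagonals of a spherical rhombus of side `60°`.**  For unit vectors with
`⟪v, b⟫ = ⟪v, x⟫ = ⟪w, b⟫ = ⟪w, x⟫ = 1/2`, `v ≠ w`, `b ≠ x`: `v + w = μ (b + x)` for a real `μ`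
with `μ (1 + ⟪b, x⟫) = 1`.  Proof: `v − w ⊥ b − x`, and `v + w`, `b + x` are both orthogonal to
`v − w` and to `b − x`; in `ℝ³` the orthogonal complement of the plane of the (nonzero,
orthogonal) vectors `v − w`, `b − x` is a line. [folklore] -/
theorem rhombus_sum_eq_smul {v w b x : E3} (hv : ‖v‖ = 1) (hw : ‖w‖ = 1) (hb : ‖b‖ = 1)
    (hx : ‖x‖ = 1) (hvb : ⟪v, b⟫ = 1 / 2) (hvx : ⟪v, x⟫ = 1 / 2) (hwb : ⟪w, b⟫ = 1 / 2)
    (hwx : ⟪w, x⟫ = 1 / 2) (hvw : v ≠ w) (hbx : b ≠ x) :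
    ∃ μ : ℝ, v + w = μ • (b + x) ∧ μ * (1 + ⟪b, x⟫) = 1 := by
  have hvv : ⟪v, v⟫ = 1 := by rw [real_inner_self_eq_norm_sq, hv, one_pow]
  have hww : ⟪w, w⟫ = 1 := by rw [real_inner_self_eq_norm_sq, hw, one_pow]
  have hbb : ⟪b, b⟫ = 1 := by rw [real_inner_self_eq_norm_sq, hb, one_pow]
  have hxx : ⟪x, x⟫ = 1 := by rw [real_inner_self_eq_norm_sq, hx, one_pow]
  have hbv : ⟪b, v⟫ = 1 / 2 := by rw [real_inner_comm]; exact hvb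
  have hxv : ⟪x, v⟫ = 1 / 2 := by rw [real_inner_comm]; exact hvx
  have hbw : ⟪b, w⟫ = 1 / 2 := by rw [real_inner_comm]; exact hwb
  have hxw : ⟪x, w⟫ = 1 / 2 := by rw [real_inner_comm]; exact hwx
  have hwv : ⟪w, v⟫ = ⟪v, w⟫ := real_inner_comm _ _
  have hxb : ⟪x, b⟫ = ⟪b, x⟫ := real_inner_comm _ _
  set d₁ := v - w with hd₁
  set d₂ := b - x with hd₂
  set s := v + w with hs
  set t := b + x with ht
  have hd₁0 : d₁ ≠ 0 := sub_ne_zero.2 hvw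
  have hd₂0 : d₂ ≠ 0 := sub_ne_zero.2 hbx
  -- `s ≠ 0`: otherwise `w = -v` and `⟪w, b⟫ = -1/2`
  have hs0 : s ≠ 0 := by
    intro h0
    have : w = -v := by rw [hs] at h0; exact (neg_eq_of_add_eq_zero_right h0).symm
    rw [this, inner_neg_left, hvb] at hwb
    norm_num at hwb
  -- orthogonality relations
  have o12 : ⟪d₁, d₂⟫ = 0 := by
    simp only [hd₁, hd₂, inner_sub_left, inner_sub_right, hvb, hvx, hwb, hwx]; ring
  have o1s : ⟪d₁, s⟫ = 0 := by
    simp only [hd₁, hs, inner_sub_left, inner_add_right, hvv, hww, hwv]; ring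
  have o2s : ⟪d₂, s⟫ = 0 := by
    simp only [hd₂, hs, inner_sub_left, inner_add_right, hbv, hbw, hxv, hxw]; ring
  have o1t : ⟪d₁, t⟫ = 0 := by
    simp only [hd₁, ht, inner_sub_left, inner_add_right, hvb, hvx, hwb, hwx]; ring
  have o2t : ⟪d₂, t⟫ = 0 := by
    simp only [hd₂, ht, inner_sub_left, inner_add_right, hbb, hxx, hxb]; ring
  -- `d₁, d₂, s` are pairwise orthogonal and nonzero, hence a basis
  have hli : LinearIndependent ℝ ![d₁, d₂, s] := by
    refine linearIndependent_of_ne_zero_of_inner_eq_zero (fun i => ?_) (fun i j hij => ?_)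
    · fin_cases i
      · exact hd₁0
      · exact hd₂0
      · exact hs0
    · fin_cases i <;> fin_cases j
      · exact absurd rfl hij
      · exact o12
      · exact o1s
      · simpa [real_inner_comm] using o12
      · exact absurd rfl hij
      · exact o2s
      · simpa [real_inner_comm] using o1s
      · simpa [real_inner_comm] using o2s
      · exact absurd rfl hij
  -- `t` minus its component along `s` is orthogonal to the basis, hence zero
  have hss : 0 < ⟪s, s⟫ := real_inner_self_pos.2 hs0
  set lam := ⟪t, s⟫ / ⟪s, s⟫ with hlam
  have hz : t - lam • s = 0 := by
    refine eq_zero_of_inner_linearIndependent_fin_three hli fun i => ?_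
    fin_cases i
    · show ⟪t - lam • s, d₁⟫ = 0
      rw [inner_sub_left, real_inner_smul_left, real_inner_comm d₁ t, real_inner_comm d₁ s, o1t,
        o1s]; ring
    · show ⟪t - lam • s, d₂⟫ = 0
      rw [inner_sub_left, real_inner_smul_left, real_inner_comm d₂ t, real_inner_comm d₂ s, o2t,
        o2s]; ring
    · show ⟪t - lam • s, s⟫ = 0
      rw [inner_sub_left, real_inner_smul_left, hlam, div_mul_cancel₀ _ hss.ne']; ring
  have hts : t = lam • s := sub_eq_zero.1 hz
  -- `lam ≠ 0` since `t ≠ 0` (`x ≠ -b` as `⟪v, x⟫ = 1/2 ≠ -1/2`)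
  have ht0 : t ≠ 0 := by
    intro h0
    have : x = -b := by rw [ht] at h0; exact (neg_eq_of_add_eq_zero_right h0).symm
    rw [this, inner_neg_right, hvb] at hvx
    norm_num at hvx
  have hlam0 : lam ≠ 0 := by
    intro h0; rw [h0, zero_smul] at hts; exact ht0 hts
  refine ⟨lam⁻¹, ?_, ?_⟩
  · rw [hts, smul_smul, inv_mul_cancel₀ hlam0, one_smul]
  · -- take the inner product of `s = lam⁻¹ t` with `b`
    have hsb : ⟪s, b⟫ = 1 := by
      simp only [hs, inner_add_left, hvb, hwb]; norm_num
    have htb : ⟪t, b⟫ = 1 + ⟪b, x⟫ := by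
      simp only [ht, inner_add_left, hbb, hxb]
    have : ⟪s, b⟫ = lam⁻¹ * ⟪t, b⟫ := by
      rw [hts, real_inner_smul_left, ← mul_assoc, inv_mul_cancel₀ hlam0, one_mul]
    rw [hsb, htb] at this
    exact this.symm

/-- **Same facet: a rhombus inscribed in a facet is a square** — if the four vertices of the
rhombus lie on the facet plane `⟪c, ·⟫ = 1`, then `⟪b, x⟫ = 0` (the diagonal `b x` has length
`√2`, i.e. `2√2` on `S²(2)`). [cite: Hales2012, proof of Lemma 3 ("with extreme case a square
of side 2")] -/
theorem inner_eq_zero_of_rhombus_tight {v w b x c : E3} (hv : ‖v‖ = 1) (hw : ‖w‖ = 1)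
    (hb : ‖b‖ = 1) (hx : ‖x‖ = 1) (hvb : ⟪v, b⟫ = 1 / 2) (hvx : ⟪v, x⟫ = 1 / 2)
    (hwb : ⟪w, b⟫ = 1 / 2) (hwx : ⟪w, x⟫ = 1 / 2) (hvw : v ≠ w) (hbx : b ≠ x)
    (hcv : ⟪c, v⟫ = 1) (hcw : ⟪c, w⟫ = 1) (hcb : ⟪c, b⟫ = 1) (hcx : ⟪c, x⟫ = 1) :
    ⟪b, x⟫ = 0 := by
  obtain ⟨μ, hsum, hμ⟩ := rhombus_sum_eq_smul hv hw hb hx hvb hvx hwb hwx hvw hbx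
  have h := congrArg (fun z => ⟪c, z⟫) hsum
  simp only [inner_add_right, real_inner_smul_right, hcv, hcw, hcb, hcx] at h
  have hμ1 : μ = 1 := by linarith
  rw [hμ1, one_mul] at hμ
  linarith

/-- **Two facets: the common base of two isosceles contact triangles in different facets is
shorter than `2√2` (on `S²(2)`)** — if `v, b, x` lie on the facet plane `⟪c, ·⟫ = 1` and
`⟪c, w⟫ < 1`, then `⟪b, x⟫ > 0`.  This is the facet form of Hales's remark that two regions of
type `(2,0,1)` cannot share their long edge ("a quadrilateral of side length `2` always has a
diagonal of length at most `√8`"). [cite: Hales2012, proof of Theorem 2 (superadditivity of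
d₃)] -/
theorem inner_pos_of_rhombus_tight {v w b x c : E3} (hv : ‖v‖ = 1) (hw : ‖w‖ = 1)
    (hb : ‖b‖ = 1) (hx : ‖x‖ = 1) (hvb : ⟪v, b⟫ = 1 / 2) (hvx : ⟪v, x⟫ = 1 / 2)
    (hwb : ⟪w, b⟫ = 1 / 2) (hwx : ⟪w, x⟫ = 1 / 2) (hvw : v ≠ w) (hbx : b ≠ x)
    (hcv : ⟪c, v⟫ = 1) (hcw : ⟪c, w⟫ < 1) (hcb : ⟪c, b⟫ = 1) (hcx : ⟪c, x⟫ = 1) :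
    0 < ⟪b, x⟫ := by
  obtain ⟨μ, hsum, hμ⟩ := rhombus_sum_eq_smul hv hw hb hx hvb hvx hwb hwx hvw hbx
  have h := congrArg (fun z => ⟪c, z⟫) hsum
  simp only [inner_add_right, real_inner_smul_right, hcv, hcb, hcx] at h
  -- `1 + ⟪c, w⟫ = 2μ < 2`, and `μ(1 + ⟪b, x⟫) = 1` with `1 + ⟪b, x⟫ > 0`
  have hμlt : μ < 1 := by linarith
  have hbx1 : -1 < ⟪b, x⟫ := by
    -- `⟪b, x⟫ = -1` would force `x = -b`, contradicting `⟪v, x⟫ = ⟪v, b⟫ = 1/2`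
    have hle : |⟪b, x⟫| ≤ 1 := by
      have := abs_real_inner_le_norm b x; rw [hb, hx, mul_one] at this; exact this
    rcases (neg_le_of_abs_le hle).lt_or_eq with hlt | heq
    · exact hlt
    · exfalso
      have h1 : ⟪b, x⟫ = -1 := heq.symm
      have hb' : b = -x := (inner_eq_neg_one_iff_of_norm_eq_one hb hx).1 h1
      rw [hb', inner_neg_right, hvx] at hvb
      norm_num at hvb
  have hpos : 0 < 1 + ⟪b, x⟫ := by linarith
  have hμpos : 0 < μ := by
    by_contra hneg
    push Not at hneg
    have := mul_nonpos_of_nonpos_of_nonneg hneg hpos.le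
    linarith
  nlinarith

/-- **The pairing lemma**: in either situation the common base `{b, x}` is not very long
(`⟪b, x⟫ ≥ 0`). [cite: Hales2012, proof of Theorem 2 (superadditivity of d₃)] -/
theorem not_inner_neg_of_rhombus_tight {v w b x c : E3} (hv : ‖v‖ = 1) (hw : ‖w‖ = 1)
    (hb : ‖b‖ = 1) (hx : ‖x‖ = 1) (hvb : ⟪v, b⟫ = 1 / 2) (hvx : ⟪v, x⟫ = 1 / 2)
    (hwb : ⟪w, b⟫ = 1 / 2) (hwx : ⟪w, x⟫ = 1 / 2) (hvw : v ≠ w) (hbx : b ≠ x)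
    (hcv : ⟪c, v⟫ = 1) (hcw : ⟪c, w⟫ ≤ 1) (hcb : ⟪c, b⟫ = 1) (hcx : ⟪c, x⟫ = 1) :
    ¬⟪b, x⟫ < 0 := by
  rcases hcw.lt_or_eq with hlt | heq
  · exact not_lt.2 (inner_pos_of_rhombus_tight hv hw hb hx hvb hvx hwb hwx hvw hbx hcv hlt hcb
      hcx).le
  · rw [inner_eq_zero_of_rhombus_tight hv hw hb hx hvb hvx hwb hwx hvw hbx hcv heq hcb hcx]
    exact lt_irrefl 0

end Pairing

end Literature.Geometry.DiscreteGeometry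

end
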